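import Summits.QuantumFields.YangMills.Theorems.InfiniteVolumeUniformBound
import Summits.QuantumFields.YangMills.Theorems.LangevinControlUVOSLegsFromFemtoAndGapStubAssemblyCompactness
import HarnessLib

/-!
# Infinite volume by compactness, step 3: the plane-string series of an infinite-volume state is a tempered
# distribution, and the «`L → ∞` first, then `a → 0`» compactness step

HONEST FRAMING (cell `ym-fleet`, seat `ym-infvol-p2`, director-ym R136 (i) «INFINITE-VOLUME ∕ CONTINUUM-FROM-UV
ROUTE», pre-birth helper; bears on LADDER-YM R1∕R2a).  Pure soft analysis, kernel-checked; NOTHING here is a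
statement about Bałaban's renormalisation group, the OS axioms of the limit, uniqueness of the infinite-volume state,
a mass gap, or Clay.  The only Yang–Mills-specific input type is the spine's UV-leg currency `MomentBounds6 G r a`,
consumed as a HYPOTHESIS (§4); §§1–3 are abstract.  No definition is posited: the lattice functional of a state is
written as the explicit series `F ↦ Σ'_{x ∈ (ℤ⁴)ⁿ} W(x)·F(y x)` and its continuity is an EXISTENCE statement
(`exists_clm_eq_tsum`), so the planner keeps the choice of the named functional (summation range, centring, offsets).

WHAT IS PROVED ([folklore] throughout).
* §1 `norm_apply_le_schwartzNorm_mul_prod` — Schwartz decay at shifted lattice points: for `‖y_l − a·x_l‖ ≤ s·a`,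
  `s·a ≤ 1/4`: `‖F y‖ ≤ 2^{6n}·‖F‖_{6n}·∏ₗ 2⁶(1 + a‖x_l‖)⁻⁶`; `sum_abs_mul_norm_le_of_bounded` — for ANY bounded weight
  `|W| ≤ B` and any `F ∈ 𝓢`: `Σ_{x ∈ T} |W x|·‖F(y x)‖ ≤ B·(2¹²·Z∕a⁴)ⁿ·‖F‖_{6n}` on every finite `T`
  (`Z = 81 Σ (m+1)⁻²`, tree `sum_prod_decay_le`); `summable_abs_mul_norm_of_bounded`.
* §2 **`exists_clm_eq_tsum`** — the series `F ↦ Σ'ₓ W(x)·F(y x)` IS a tempered distribution: there is a continuous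
  linear functional on `𝓢((Fin n → E4), ℂ)` with these values (Mathlib `SchwartzMap.mkCLMtoNormedSpace`).
* §3 **`exists_subseq_limit_of_zdCollar`** — THE COMPACTNESS STEP IN INFINITE VOLUME, abstract form: along any
  sequence of scales `0 < a_k ≤ min (1/24) ℓ₄`, weights `W_k(n, q, ·)` on `(ℤ⁴)ⁿ` with sup bound `Mⁿ` and `ℤ⁴`-collar
  bound `(C/R⁴)ⁿ` at scale `a_k` (valid strings), and evaluation maps within `6·a_k` of `a_k·x`, there are ONE
  subsequence `φ` and continuous linear functionals `S n q` with `‖S n q F‖ ≤ 5Kⁿ·‖F‖_{10n}` EVERYWHERE such that for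
  `n ≥ 2`, valid `q` and `F ∈ ⁰𝒮ₙ`: `Σ'ₓ W_{φ j}(n,q,x)·F(y_{φ j} x) → S n q F` (step 2's uniform bound + tree
  `exists_subseq_clm_limit` BY NAME).
* §4 **`exists_subseq_limit_oddTorusLimitPoints`** — from `MomentBounds6 G r a`: thresholds `β₄`, `ℓ₄` and ONE `K`
  such that for EVERY coupling sequence `β_k ≥ β₄` with `0 < a(β_k) ≤ min (1/24) ℓ₄`, EVERY choice of
  thermodynamic limit states `μ_k ∈ oddTorusLimitPoints r (β_k)` and every admissible offset scheme, a subsequence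
  and limit functionals as in §3 exist for the centred plane-string series of the `μ_k` — the continuum data
  candidates of the «`L → ∞` first» route, with the E0′ bound.

References: Glimm–Jaffe (1987) §6.1; Osterwalder–Schrader CMP 42 (1975) §2; Chatterjee arXiv:1803.01950 §§2, 5.
-/

set_option autoImplicit false

noncomputable section

open scoped BigOperators SchwartzMap
open MeasureTheory Filter Topology
open Literature.MathematicalPhysics.QuantumFieldTheory hiding ZdEdge
open Literature.MathematicalPhysics.QuantumLattice
open Literature.MathematicalPhysics.AQFT
open Literature.Probability.LatticeModels (box Site)
open Summit.QuantumFields.YangMills.Cruxes.OSLegsFromFemtoAndGap.DlrCollarTransfer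
  (plane MomentBounds6 exists_abs_plane_le)
open Summit.QuantumFields.YangMills.Theorems.OSLegsFromFemtoAndGap
  (inv_one_add_norm_pow_le_prod' norm_ge_of_shift sum_prod_decay_le exists_subseq_clm_limit)

namespace Summit.QuantumFields.YangMills.Theorems.InfiniteVolume

/-! ## §1 Schwartz decay at shifted lattice points; bounded weights give convergent series -/

section Decay

variable {n : ℕ}

/-- **Schwartz decay at shifted lattice points.**  If `‖y_l − a·x_l‖ ≤ s·a` for all `l` with `0 ≤ a`, `s·a ≤ 1/4`,
then `‖F y‖ ≤ 2^{6n}·‖F‖_{6n}·∏ₗ 2⁶·((1 + a‖x_l‖)⁶)⁻¹` (`‖F‖_{6n} = schwartzNorm (6n) F`). [folklore] -/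
theorem norm_apply_le_schwartzNorm_mul_prod {a s : ℝ} (ha : 0 ≤ a) (hsa : s * a ≤ 1 / 4)
    (F : 𝓢((Fin n → EuclideanSpace ℝ (Fin 4)), ℂ)) (x : Fin n → Site 4)
    (y : Fin n → EuclideanSpace ℝ (Fin 4)) (hyx : ∀ l, ‖y l - a • siteToE (x l)‖ ≤ s * a) :
    ‖F y‖ ≤ 2 ^ (6 * n) * schwartzNorm (6 * n) F * ∏ i, (2 ^ 6 * ((1 + a * ‖x i‖) ^ 6)⁻¹) := by
  have h1 := SchwartzMap.one_add_le_sup_seminorm_apply (𝕜 := ℂ) (m := (6 * n, 6 * n)) (k := 6 * n) (n := 0)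
    le_rfl (Nat.zero_le _) F y
  rw [norm_iteratedFDeriv_zero] at h1
  have hSN : (Finset.Iic (6 * n, 6 * n)).sup (fun m => SchwartzMap.seminorm ℂ m.1 m.2) F =
      schwartzNorm (6 * n) F := rfl
  rw [hSN] at h1
  have hq : 0 < (1 + ‖y‖) ^ (6 * n) := by positivity
  have h2 : ‖F y‖ ≤ 2 ^ (6 * n) * schwartzNorm (6 * n) F * ((1 + ‖y‖) ^ (6 * n))⁻¹ := by
    rw [← div_eq_mul_inv, le_div_iff₀ hq, mul_comm]; exact h1
  have hyhalf : ∀ i, a * ‖x i‖ ≤ ‖y i‖ + 1 / 2 := fun i => by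
    have := norm_ge_of_shift ha hyx i
    linarith
  have h3 : ((1 + ‖y‖) ^ (6 * n))⁻¹ ≤ ∏ i, (2 ^ 6 * ((1 + a * ‖x i‖) ^ 6)⁻¹) := by
    have := inv_one_add_norm_pow_le_prod' ha x y hyhalf 6
    rw [inv_pow, ← pow_mul] at this
    exact this
  calc ‖F y‖ ≤ 2 ^ (6 * n) * schwartzNorm (6 * n) F * ((1 + ‖y‖) ^ (6 * n))⁻¹ := h2
    _ ≤ 2 ^ (6 * n) * schwartzNorm (6 * n) F * ∏ i, (2 ^ 6 * ((1 + a * ‖x i‖) ^ 6)⁻¹) := by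
        gcongr
        exact mul_nonneg (by positivity) (schwartzNorm_nonneg _ _)

/-- **Bounded weights give an absolutely convergent series against any Schwartz function**: with `|W x| ≤ B`,
`0 < a ≤ 1`, `s·a ≤ 1/4` and shifted evaluation points, on every finite `T`:
`Σ_{x ∈ T} |W x|·‖F(y x)‖ ≤ B·(2⁶·(2⁶Z)·a⁻⁴)ⁿ·‖F‖_{6n}`, `Z = 81 Σ (m+1)⁻²`.  (The constant depends on `a`: this is
continuity of ONE lattice functional, not the a-uniform bound of step 2.) [folklore] -/
theorem sum_abs_mul_norm_le_of_bounded {a s B : ℝ} (ha : 0 < a) (ha1 : a ≤ 1) (hsa : s * a ≤ 1 / 4) (hB : 0 ≤ B)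
    (W : (Fin n → Site 4) → ℝ) (hW : ∀ x, |W x| ≤ B) (F : 𝓢((Fin n → EuclideanSpace ℝ (Fin 4)), ℂ))
    (y : (Fin n → Site 4) → (Fin n → EuclideanSpace ℝ (Fin 4)))
    (hyx : ∀ x l, ‖y x l - a • siteToE (x l)‖ ≤ s * a) (T : Finset (Fin n → Site 4)) :
    ∑ x ∈ T, |W x| * ‖F (y x)‖ ≤
      B * (2 ^ 6 * (2 ^ 6 * (81 * ∑' m : ℕ, (((m : ℝ) + 1) ^ 2)⁻¹)) * (a ^ 4)⁻¹) ^ n * schwartzNorm (6 * n) F := by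
  classical
  obtain ⟨Z, hZ⟩ : ∃ Z : ℝ, 81 * ∑' m : ℕ, (((m : ℝ) + 1) ^ 2)⁻¹ = Z := ⟨_, rfl⟩
  have hZ0 : 0 ≤ Z := by rw [← hZ]; exact mul_nonneg (by norm_num) (tsum_nonneg fun m => by positivity)
  have hSN := schwartzNorm_nonneg (6 * n) F
  obtain ⟨L, -, hTL⟩ := subset_piFinset_box T 0
  -- per point
  have hpt : ∀ x : Fin n → Site 4, |W x| * ‖F (y x)‖ ≤
      B * (2 ^ (6 * n) * schwartzNorm (6 * n) F) *
        ((2 ^ 6 * (a ^ 4)⁻¹) ^ n * ∏ i, (a ^ 4 * ((1 + a * ‖x i‖) ^ 6)⁻¹)) := fun x => by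
    have hF := norm_apply_le_schwartzNorm_mul_prod ha.le hsa F x (y x) (hyx x)
    have hfac : ∏ i, (2 ^ 6 * ((1 + a * ‖x i‖) ^ 6)⁻¹) =
        (2 ^ 6 * (a ^ 4)⁻¹) ^ n * ∏ i, (a ^ 4 * ((1 + a * ‖x i‖) ^ 6)⁻¹) := by
      have h4 : (a : ℝ) ^ 4 ≠ 0 := pow_ne_zero 4 ha.ne'
      have hi : ∀ i : Fin n, (2 : ℝ) ^ 6 * ((1 + a * ‖x i‖) ^ 6)⁻¹ =
          (2 ^ 6 * (a ^ 4)⁻¹) * (a ^ 4 * ((1 + a * ‖x i‖) ^ 6)⁻¹) := fun i => by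
        rw [mul_assoc, ← mul_assoc ((a ^ 4)⁻¹), inv_mul_cancel₀ h4, one_mul]
      rw [Finset.prod_congr rfl fun i _ => hi i, Finset.prod_mul_distrib, Finset.prod_const, Finset.card_univ,
        Fintype.card_fin]
    rw [hfac] at hF
    calc |W x| * ‖F (y x)‖ ≤ B * (2 ^ (6 * n) * schwartzNorm (6 * n) F *
          ((2 ^ 6 * (a ^ 4)⁻¹) ^ n * ∏ i, (a ^ 4 * ((1 + a * ‖x i‖) ^ 6)⁻¹))) :=
          mul_le_mul (hW x) hF (norm_nonneg _) hB
      _ = _ := by ring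
  rw [hZ]
  calc ∑ x ∈ T, |W x| * ‖F (y x)‖
      ≤ ∑ x ∈ Fintype.piFinset (fun _ : Fin n => box 4 L), |W x| * ‖F (y x)‖ :=
        Finset.sum_le_sum_of_subset_of_nonneg hTL fun x _ _ => by positivity
    _ ≤ ∑ x ∈ Fintype.piFinset (fun _ : Fin n => box 4 L), B * (2 ^ (6 * n) * schwartzNorm (6 * n) F) *
        ((2 ^ 6 * (a ^ 4)⁻¹) ^ n * ∏ i, (a ^ 4 * ((1 + a * ‖x i‖) ^ 6)⁻¹)) := Finset.sum_le_sum fun x _ => hpt x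
    _ = B * (2 ^ (6 * n) * schwartzNorm (6 * n) F) * (2 ^ 6 * (a ^ 4)⁻¹) ^ n *
        ∑ x ∈ Fintype.piFinset (fun _ : Fin n => box 4 L), ∏ i, (a ^ 4 * ((1 + a * ‖x i‖) ^ 6)⁻¹) := by
        rw [Finset.mul_sum]; exact Finset.sum_congr rfl fun x _ => by ring
    _ ≤ B * (2 ^ (6 * n) * schwartzNorm (6 * n) F) * (2 ^ 6 * (a ^ 4)⁻¹) ^ n * Z ^ n := by
        refine mul_le_mul_of_nonneg_left ?_ (mul_nonneg (mul_nonneg hB (by positivity)) (by positivity))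
        rw [← hZ]; exact sum_prod_decay_le ha ha1 (le_refl 6) (box 4 L) n
    _ = B * (2 ^ 6 * (2 ^ 6 * Z) * (a ^ 4)⁻¹) ^ n * schwartzNorm (6 * n) F := by
        rw [show (2 : ℝ) ^ (6 * n) = (2 ^ 6) ^ n from pow_mul 2 6 n, mul_pow, mul_pow, mul_pow]; ring

/-- **Summability** of `x ↦ |W x|·‖F(y x)‖` over `(ℤ⁴)ⁿ` for bounded weights and any Schwartz `F`. [folklore] -/
theorem summable_abs_mul_norm_of_bounded {a s B : ℝ} (ha : 0 < a) (ha1 : a ≤ 1) (hsa : s * a ≤ 1 / 4) (hB : 0 ≤ B)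
    (W : (Fin n → Site 4) → ℝ) (hW : ∀ x, |W x| ≤ B) (F : 𝓢((Fin n → EuclideanSpace ℝ (Fin 4)), ℂ))
    (y : (Fin n → Site 4) → (Fin n → EuclideanSpace ℝ (Fin 4)))
    (hyx : ∀ x l, ‖y x l - a • siteToE (x l)‖ ≤ s * a) :
    Summable fun x : Fin n → Site 4 => |W x| * ‖F (y x)‖ :=
  summable_of_sum_le (fun x => by positivity) (sum_abs_mul_norm_le_of_bounded ha ha1 hsa hB W hW F y hyx)

/-- Summability of the complex series `x ↦ W(x)·F(y x)`. [folklore] -/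
theorem summable_mul_of_bounded {a s B : ℝ} (ha : 0 < a) (ha1 : a ≤ 1) (hsa : s * a ≤ 1 / 4) (hB : 0 ≤ B)
    (W : (Fin n → Site 4) → ℝ) (hW : ∀ x, |W x| ≤ B) (F : 𝓢((Fin n → EuclideanSpace ℝ (Fin 4)), ℂ))
    (y : (Fin n → Site 4) → (Fin n → EuclideanSpace ℝ (Fin 4)))
    (hyx : ∀ x l, ‖y x l - a • siteToE (x l)‖ ≤ s * a) :
    Summable fun x : Fin n → Site 4 => ((W x : ℝ) : ℂ) * F (y x) := by
  refine Summable.of_norm_bounded (summable_abs_mul_norm_of_bounded ha ha1 hsa hB W hW F y hyx) fun x => ?_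
  rw [norm_mul, Complex.norm_real, Real.norm_eq_abs]

end Decay

/-! ## §2 The series functional is a tempered distribution -/

section CLM

variable {n : ℕ}

/-- **The plane-string series of a bounded weight is a tempered distribution.**  For `|W| ≤ B`, `0 < a ≤ 1`,
`s·a ≤ 1/4` and evaluation points `‖(y x)_l − a·x_l‖ ≤ s·a`, there is a continuous linear functional `T` on
`𝓢((Fin n → E4), ℂ)` with `T F = Σ'ₓ W(x)·F(y x)` for every `F` (no definition is posited; Mathlib
`SchwartzMap.mkCLMtoNormedSpace` with the bound of `sum_abs_mul_norm_le_of_bounded`). [folklore] -/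
theorem exists_clm_eq_tsum {a s B : ℝ} (ha : 0 < a) (ha1 : a ≤ 1) (hsa : s * a ≤ 1 / 4) (hB : 0 ≤ B)
    (W : (Fin n → Site 4) → ℝ) (hW : ∀ x, |W x| ≤ B)
    (y : (Fin n → Site 4) → (Fin n → EuclideanSpace ℝ (Fin 4)))
    (hyx : ∀ x l, ‖y x l - a • siteToE (x l)‖ ≤ s * a) :
    ∃ T : 𝓢((Fin n → EuclideanSpace ℝ (Fin 4)), ℂ) →L[ℂ] ℂ,
      ∀ F, T F = ∑' x : Fin n → Site 4, ((W x : ℝ) : ℂ) * F (y x) := by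
  have hsum := fun F => summable_mul_of_bounded ha ha1 hsa hB W hW F y hyx
  set D : ℝ := B * (2 ^ 6 * (2 ^ 6 * (81 * ∑' m : ℕ, (((m : ℝ) + 1) ^ 2)⁻¹)) * (a ^ 4)⁻¹) ^ n with hD
  have hD0 : 0 ≤ D := by
    have : 0 ≤ ∑' m : ℕ, (((m : ℝ) + 1) ^ 2)⁻¹ := tsum_nonneg fun m => by positivity
    positivity
  refine ⟨SchwartzMap.mkCLMtoNormedSpace (𝕜 := ℂ) (𝕜' := ℂ) (σ := RingHom.id ℂ)
    (fun F => ∑' x : Fin n → Site 4, ((W x : ℝ) : ℂ) * F (y x)) (fun F₁ F₂ => ?_) (fun c F => ?_)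
    ⟨Finset.Iic (6 * n, 6 * n), D, hD0, fun F => ?_⟩, fun F => rfl⟩
  · rw [← Summable.tsum_add (hsum F₁) (hsum F₂)]
    exact tsum_congr fun x => by simp only [add_apply]; ring
  · simp only [smul_apply, smul_eq_mul, RingHom.id_apply]
    rw [← tsum_mul_left]
    exact tsum_congr fun x => by ring
  · have hnorm : ∀ x : Fin n → Site 4, ‖((W x : ℝ) : ℂ) * F (y x)‖ = |W x| * ‖F (y x)‖ := fun x => by
      rw [norm_mul, Complex.norm_real, Real.norm_eq_abs]
    have habs := summable_abs_mul_norm_of_bounded ha ha1 hsa hB W hW F y hyx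
    calc ‖∑' x : Fin n → Site 4, ((W x : ℝ) : ℂ) * F (y x)‖
        ≤ ∑' x : Fin n → Site 4, ‖((W x : ℝ) : ℂ) * F (y x)‖ := norm_tsum_le_tsum_norm (by simpa [hnorm] using habs)
      _ = ∑' x : Fin n → Site 4, |W x| * ‖F (y x)‖ := by simp_rw [hnorm]
      _ ≤ D * schwartzNorm (6 * n) F :=
          Real.tsum_le_of_sum_le (fun x => by positivity) (sum_abs_mul_norm_le_of_bounded ha ha1 hsa hB W hW F y hyx)
      _ = D * (Finset.Iic (6 * n, 6 * n)).sup (schwartzSeminormFamily ℂ (Fin n → EuclideanSpace ℝ (Fin 4)) ℂ) F :=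
          rfl

end CLM

/-! ## §3 The compactness step in infinite volume (abstract weights) -/

section Compactness

/-- **THE COMPACTNESS STEP, INFINITE VOLUME, ABSTRACT FORM.**  Scales `0 < a_k ≤ 1/24`, `a_k ≤ ℓ₄`; for each `k`,
arity `n` and plane string `q`, a weight `W k n q` on `(ℤ⁴)ⁿ` with sup bound `Mⁿ` and — for valid strings — the
`ℤ⁴`-collar bound `(C/R⁴)ⁿ` at scale `a_k` (`1 ≤ R`, `R·a_k ≤ ℓ₄`), and evaluation maps `y k n q` within `6·a_k` of
`a_k·x`.  Then there are ONE strictly increasing `φ` and continuous linear functionals `S n q` with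
`‖S n q F‖ ≤ 5Kⁿ·‖F‖_{10n}` for ALL `F` (`K` = step 2's constant), such that for every `n ≥ 2`, valid `q` and
`F ∈ ⁰𝒮ₙ`: `Σ'ₓ W (φ j) n q x · F (y (φ j) n q x) → S n q F`.  (Step 2's a-uniform bound on `⁰𝒮ₙ` + §2 + the
tree's `exists_subseq_clm_limit`; invalid strings carry the zero functional.) [folklore] -/
theorem exists_subseq_limit_of_zdCollar {C ℓ₄ M : ℝ} (hℓ : 0 < ℓ₄) (hC : 0 ≤ C) (hM : 0 ≤ M)
    (a : ℕ → ℝ) (ha : ∀ k, 0 < a k) (ha24 : ∀ k, a k ≤ 1 / 24) (haℓ : ∀ k, a k ≤ ℓ₄)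
    (W : ℕ → (n : ℕ) → (Fin n → Fin 4 × Fin 4) → (Fin n → Site 4) → ℝ)
    (hWsup : ∀ k n q x, |W k n q x| ≤ M ^ n)
    (hWcol : ∀ (k n : ℕ) (q : Fin n → Fin 4 × Fin 4), (∀ i, (q i).1 < (q i).2) →
      ∀ (x : Fin n → Site 4) (R : ℕ), 1 ≤ R → (R : ℝ) * a k ≤ ℓ₄ →
        (∀ i j : Fin n, i ≠ j → ∃ m : Fin 4, (2 * (R : ℤ) + 4) ≤ |x i m - x j m|) →
        |W k n q x| ≤ (C / (R : ℝ) ^ 4) ^ n)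
    (y : ℕ → (n : ℕ) → (Fin n → Fin 4 × Fin 4) → (Fin n → Site 4) → (Fin n → EuclideanSpace ℝ (Fin 4)))
    (hy : ∀ k n q x l, ‖y k n q x l - a k • siteToE (x l)‖ ≤ 6 * a k) :
    ∃ φ : ℕ → ℕ, StrictMono φ ∧
      ∃ S : (n : ℕ) → (Fin n → Fin 4 × Fin 4) → (𝓢((Fin n → EuclideanSpace ℝ (Fin 4)), ℂ) →L[ℂ] ℂ),
        (∀ n q F, ‖S n q F‖ ≤
          5 * (((M * 4 ^ 4 * 5 ^ 6 + M * 2 ^ 6 * (10 + 2 * 6) ^ 4 + 16 * C * 2 ^ 6 * (2 / ℓ₄ + 48) ^ 4) * 2 ^ 6 *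
            (81 * ∑' m : ℕ, (((m : ℝ) + 1) ^ 2)⁻¹)) ^ n) * schwartzNorm (10 * n) F) ∧
        ∀ n : ℕ, 2 ≤ n → ∀ q : Fin n → Fin 4 × Fin 4, (∀ i, (q i).1 < (q i).2) →
          ∀ F : 𝓢((Fin n → EuclideanSpace ℝ (Fin 4)), ℂ), IsOffDiagonal F →
            Tendsto (fun j => ∑' x : Fin n → Site 4, ((W (φ j) n q x : ℝ) : ℂ) * F (y (φ j) n q x)) atTop
              (𝓝 (S n q F)) := by
  classical
  set K : ℝ := (M * 4 ^ 4 * 5 ^ 6 + M * 2 ^ 6 * (10 + 2 * 6) ^ 4 + 16 * C * 2 ^ 6 * (2 / ℓ₄ + 48) ^ 4) * 2 ^ 6 *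
    (81 * ∑' m : ℕ, (((m : ℝ) + 1) ^ 2)⁻¹) with hK
  have hK0 : 0 ≤ K := by
    have : 0 ≤ ∑' m : ℕ, (((m : ℝ) + 1) ^ 2)⁻¹ := tsum_nonneg fun m => by positivity
    positivity
  have ha1 : ∀ k, a k ≤ 1 := fun k => (ha24 k).trans (by norm_num)
  have hsa : ∀ k, 6 * a k ≤ 1 / 4 := fun k => by linarith [ha24 k]
  have hMn : ∀ n : ℕ, 0 ≤ M ^ n := fun n => pow_nonneg hM n
  -- the series functionals as continuous linear functionals
  have hT : ∀ (k n : ℕ) (q : Fin n → Fin 4 × Fin 4),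
      ∃ T : 𝓢((Fin n → EuclideanSpace ℝ (Fin 4)), ℂ) →L[ℂ] ℂ,
        ∀ F, T F = ∑' x : Fin n → Site 4, ((W k n q x : ℝ) : ℂ) * F (y k n q x) := fun k n q =>
    exists_clm_eq_tsum (ha k) (ha1 k) (hsa k) (hMn n) (W k n q) (hWsup k n q) (y k n q) (hy k n q)
  choose T hT using hT
  -- the joint index and the off-diagonal submodules
  let ι := Σ n : ℕ, (Fin n → Fin 4 × Fin 4)
  let Tι : (i : ι) → ℕ → (𝓢((Fin i.1 → EuclideanSpace ℝ (Fin 4)), ℂ) →L[ℂ] ℂ) := fun i k =>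
    if 2 ≤ i.1 ∧ (∀ l, (i.2 l).1 < (i.2 l).2) then T k i.1 i.2 else 0
  let Mod : (i : ι) → Submodule ℂ 𝓢((Fin i.1 → EuclideanSpace ℝ (Fin 4)), ℂ) := fun i =>
    { carrier := {F | IsOffDiagonal F}
      add_mem' := fun hF hG => hF.add hG
      zero_mem' := isOffDiagonal_zero
      smul_mem' := fun c _ hF => hF.smul c }
  have hMod : ∀ i (F : 𝓢((Fin i.1 → EuclideanSpace ℝ (Fin 4)), ℂ)), F ∈ Mod i ↔ IsOffDiagonal F :=
    fun i F => Iff.rfl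
  -- the a-uniform bound on `⁰𝒮` (step 2)
  have hbound : ∀ i k, ∀ F ∈ Mod i, ‖Tι i k F‖ ≤ 5 * K ^ i.1 * schwartzNorm (10 * i.1) F := by
    rintro ⟨n, q⟩ k F hF
    rw [hMod] at hF
    by_cases hn : 2 ≤ n ∧ (∀ l, (q l).1 < (q l).2)
    · simp only [Tι, if_pos hn, hT]
      exact norm_tsum_weight_mul_le hℓ hC hM (W k n q) (hWsup k n q) (hWcol k n q hn.2) (ha k) (ha1 k) (haℓ k)
        hn.1 (by norm_num) le_rfl (hsa k) F hF (y k n q) (hy k n q)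
    · simp only [Tι, if_neg hn, zero_apply, norm_zero]
      exact mul_nonneg (by positivity) (schwartzNorm_nonneg _ _)
  obtain ⟨φ, hφ, Slim, hSlim, hconv⟩ := exists_subseq_clm_limit
    (X := fun i : ι => Fin i.1 → EuclideanSpace ℝ (Fin 4)) Tι Mod (fun i => 10 * i.1) (fun i => 5 * K ^ i.1)
    (fun i => by positivity) hbound
  refine ⟨φ, hφ, fun n q => Slim ⟨n, q⟩, fun n q F => ?_, fun n hn q hq F hF => ?_⟩
  · exact hSlim ⟨n, q⟩ F
  · have h := hconv ⟨n, q⟩ F ((hMod ⟨n, q⟩ F).2 hF)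
    simp only [Tι, if_pos (And.intro hn hq), hT] at h
    exact h

end Compactness

/-! ## §4 From `MomentBounds6`: the compactness step for odd-torus limit states -/

section OddTorus

variable {G : Type} [Group G] [TopologicalSpace G] [IsTopologicalGroup G] [CompactSpace G]
  [MeasurableSpace G] [BorelSpace G]

/-- **THE COMPACTNESS STEP FOR THERMODYNAMIC LIMIT STATES.**  From `MomentBounds6 G r a` there are thresholds `β₄`,
`ℓ₄ > 0` and ONE `K ≥ 0` such that: for EVERY coupling sequence `β_k` with `β₄ ≤ β_k`, `0 < a(β_k) ≤ 1/24`,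
`a(β_k) ≤ ℓ₄`, EVERY choice of states `μ_k ∈ oddTorusLimitPoints r (β_k)` and EVERY offset scheme `y` with
`‖(y k n q x)_l − a(β_k)·x_l‖ ≤ 6·a(β_k)`, there are a strictly increasing `φ` and continuous linear functionals
`S n q` on `𝓢((Fin n → E4), ℂ)` with `‖S n q F‖ ≤ 5Kⁿ·‖F‖_{10n}` everywhere, such that for `n ≥ 2`, valid `q`,
`F ∈ ⁰𝒮ₙ`: the centred plane-string series of `μ_{φ j}` at `F` tends to `S n q F`.  These `S n q` are the
continuum-data candidates of the «`L → ∞` first, then `a → 0`» extraction, with the E0′ bound. [folklore] -/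
theorem exists_subseq_limit_oddTorusLimitPoints (r : LatticeRep G) {a : ℝ → ℝ} (hMB : MomentBounds6 G r a) :
    ∃ (β₄ ℓ₄ K : ℝ), 0 < ℓ₄ ∧ 0 ≤ K ∧
      ∀ (β : ℕ → ℝ), (∀ k, β₄ ≤ β k) → (∀ k, 0 < a (β k)) → (∀ k, a (β k) ≤ 1 / 24) → (∀ k, a (β k) ≤ ℓ₄) →
      ∀ (μ : ℕ → Measure (LGConfig 4 G)), (∀ k, μ k ∈ oddTorusLimitPoints r (β k)) →
      ∀ (y : ℕ → (n : ℕ) → (Fin n → Fin 4 × Fin 4) → (Fin n → Site 4) → (Fin n → EuclideanSpace ℝ (Fin 4))),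
        (∀ k n q x l, ‖y k n q x l - a (β k) • siteToE (x l)‖ ≤ 6 * a (β k)) →
      ∃ φ : ℕ → ℕ, StrictMono φ ∧
        ∃ S : (n : ℕ) → (Fin n → Fin 4 × Fin 4) → (𝓢((Fin n → EuclideanSpace ℝ (Fin 4)), ℂ) →L[ℂ] ℂ),
          (∀ n q F, ‖S n q F‖ ≤ 5 * K ^ n * schwartzNorm (10 * n) F) ∧
          ∀ n : ℕ, 2 ≤ n → ∀ q : Fin n → Fin 4 × Fin 4, (∀ i, (q i).1 < (q i).2) →
            ∀ F : 𝓢((Fin n → EuclideanSpace ℝ (Fin 4)), ℂ), IsOffDiagonal F →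
              Tendsto (fun j => ∑' x : Fin n → Site 4,
                (((∫ U, ∏ i, (plane G r (q i) (x i) U - ∫ V, plane G r (q i) (x i) V ∂(μ (φ j))) ∂(μ (φ j)) : ℝ)
                  : ℂ)) * F (y (φ j) n q x)) atTop (𝓝 (S n q F)) := by
  obtain ⟨C, β₄, ℓ₄, hℓ, hC, H⟩ := hMB
  obtain ⟨Cp, hCp⟩ := exists_abs_plane_le (G := G) r
  have hCp0 : 0 ≤ Cp := le_trans (abs_nonneg _) (hCp (0, 1) 0 (fun _ => 1))
  refine ⟨β₄, ℓ₄, ((Cp + Cp) * 4 ^ 4 * 5 ^ 6 + (Cp + Cp) * 2 ^ 6 * (10 + 2 * 6) ^ 4 +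
      16 * C * 2 ^ 6 * (2 / ℓ₄ + 48) ^ 4) * 2 ^ 6 * (81 * ∑' m : ℕ, (((m : ℝ) + 1) ^ 2)⁻¹), hℓ, ?_, ?_⟩
  · have : 0 ≤ ∑' m : ℕ, (((m : ℝ) + 1) ^ 2)⁻¹ := tsum_nonneg fun m => by positivity
    positivity
  intro β hβ ha ha24 haℓ μ hμ y hy
  haveI : ∀ k, IsProbabilityMeasure (μ k) := fun k => by
    obtain ⟨S, -, hlim⟩ := hμ k
    exact hlim.1
  obtain ⟨φ, hφ, S, hS, hconv⟩ := exists_subseq_limit_of_zdCollar hℓ hC (by positivity : 0 ≤ Cp + Cp)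
    (fun k => a (β k)) ha ha24 haℓ
    (fun k n q x => ∫ U, ∏ i, (plane G r (q i) (x i) U - ∫ V, plane G r (q i) (x i) V ∂(μ k)) ∂(μ k))
    (fun k n q x => abs_infVolWeight_le r hCp (μ k) q x)
    (fun k n q hq x R hR hRa hsep => momentBounds6_oddTorusLimitPoints r H (hβ k) (hμ k) q x R hq hR hRa hsep)
    y hy
  exact ⟨φ, hφ, S, hS, hconv⟩

end OddTorus

end Summit.QuantumFields.YangMills.Theorems.InfiniteVolume

end
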